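import Summits.Parity.BatemanHorn.Theorems.SoloInformedPartialSummation

/-!
# SoloInformedPartialSummationPow — partial summation for weights `w(n) ~ D log^k n`

Solo unit `solo-Parity-informed` (ideation tier, informed mode), session 16; `PLAN.md` §24.1, CLAIMS C68.

`SoloInformedPartialSummation` treated weights `d log n + O(1)` (one polynomial).  For a Bateman–Horn SYSTEM of
`k` polynomials the natural weight at an `n` all of whose values are prime is `∏ᵢ log |fᵢ(n)| ~ D log^k n`
(`D = ∏ᵢ deg fᵢ`), and the conjectured main term is `(C/D) · x / log^k x`.  This file proves the corresponding
abstract partial summation: for a decidable predicate `p` on `ℕ`, a weight `w ≥ 0` with `w(n) ~ D log^k n`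
(`n → ∞`, `D > 0`, `k ≠ 0`) and `C > 0`,

  `θ(x) := ∑_{1 ≤ n ≤ x, p n} w(n) ~ C x   ⟺   P(x) := #{1 ≤ n ≤ x : p n} ~ (C/D) · x / log^k x`

(`isEquivalent_weightedSum_iff_card_pow`).  The proof is the one of the `k = 1` file with the cut
`y = ⌊x^{1-ε}⌋`, `ε = a/(2(k+1))`: beyond the cut `log^k n ≥ (1-ε)^k log^k x ≥ (1 - a/2) log^k x` (Bernoulli),
and the cut costs `y · D log^k x = o(x)`.  Elementary real analysis (Mathlib only).
-/

namespace Summit.Parity.BatemanHorn.Theorems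

open Finset Filter Asymptotics
open scoped Topology

/-! ### Fixed-`x` upper inequality with a uniform level -/

/-- If every counted `1 ≤ n ≤ x` weighs at most `M`, then `θ(x) ≤ P(x) · M`. -/
theorem weightedCount_le_card_mul_of_le {p : ℕ → Prop} [DecidablePred p] {w : ℕ → ℝ} {M : ℝ}
    (x : ℕ) (hM : ∀ n ∈ Icc 1 x, w n ≤ M) :
    ∑ n ∈ (Icc 1 x).filter p, w n ≤ (#((Icc 1 x).filter p) : ℝ) * M := by
  rw [← nsmul_eq_mul]
  exact sum_le_card_nsmul _ _ _ fun n hn => hM n (mem_filter.mp hn).1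

/-! ### Scalar cores (`m = (C/D) X / log^k X`, `L = D log^k X`, so that `m L = C X`) -/

/-- Core of "weighted-sum upper bound ⟹ count upper bound". -/
theorem card_upper_core_pow {P y a m L T : ℝ} (hL : 0 < L) (hm : 0 < m) (ha : 0 < a)
    (ha1 : a ≤ 1 / 8) (hLB : (P - y) * ((1 - a) * L) ≤ T) (hT : T ≤ (1 + a) * (m * L))
    (hy : y * L ≤ a * (m * L)) : P ≤ (1 + 4 * a) * m := by
  have h1a : 0 < 1 - a := by linarith
  have h1 : (P - y) * (1 - a) ≤ (1 + a) * m := by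
    have h := hLB.trans hT
    rw [show (P - y) * ((1 - a) * L) = (P - y) * (1 - a) * L by ring,
      show (1 + a) * (m * L) = (1 + a) * m * L by ring] at h
    exact le_of_mul_le_mul_right h hL
  have h2 : y ≤ a * m := by
    rw [show a * (m * L) = a * m * L by ring] at hy
    exact le_of_mul_le_mul_right hy hL
  have h3 : y * (1 - a) ≤ a * m * (1 - a) := mul_le_mul_of_nonneg_right h2 h1a.le
  have h4 : 0 ≤ a * m * (1 - 3 * a) := mul_nonneg (by positivity) (by linarith)
  refine le_of_mul_le_mul_right ?_ h1a
  nlinarith [h1, h3, h4]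

/-- Core of "weighted-sum lower bound ⟹ count lower bound". -/
theorem card_lower_core_pow {P a m L T : ℝ} (hL : 0 < L) (hm : 0 < m) (ha : 0 < a)
    (hU : T ≤ P * ((1 + a) * L)) (hT : (1 - a) * (m * L) ≤ T) : (1 - 2 * a) * m ≤ P := by
  have h1a : 0 < 1 + a := by linarith
  have h1 : (1 - a) * m ≤ P * (1 + a) := by
    have h := hT.trans hU
    rw [show (1 - a) * (m * L) = (1 - a) * m * L by ring,
      show P * ((1 + a) * L) = P * (1 + a) * L by ring] at h
    exact le_of_mul_le_mul_right h hL
  have h2 : 0 ≤ a ^ 2 * m := by positivity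
  refine le_of_mul_le_mul_right ?_ h1a
  nlinarith [h1, h2]

/-- Core of "count upper bound ⟹ weighted-sum upper bound". -/
theorem weightedSum_upper_core_pow {P a m L T : ℝ} (hL : 0 < L) (hm : 0 < m) (ha : 0 < a)
    (ha1 : a ≤ 1) (hU : T ≤ P * ((1 + a) * L)) (hP : P ≤ (1 + a) * m) :
    T ≤ (1 + 3 * a) * (m * L) := by
  have h1 : P * ((1 + a) * L) ≤ (1 + a) * m * ((1 + a) * L) :=
    mul_le_mul_of_nonneg_right hP (by positivity)
  have h2 : a ^ 2 * (m * L) ≤ a * (m * L) :=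
    mul_le_mul_of_nonneg_right (by nlinarith) (by positivity)
  nlinarith [hU, h1, h2]

/-- Core of "count lower bound ⟹ weighted-sum lower bound". -/
theorem weightedSum_lower_core_pow {P y a m L T : ℝ} (hL : 0 < L) (hm : 0 < m) (ha : 0 < a)
    (ha1 : a ≤ 1) (hy0 : 0 ≤ y) (hLB : (P - y) * ((1 - a) * L) ≤ T) (hP : (1 - a) * m ≤ P)
    (hy : y * L ≤ a * (m * L)) : (1 - 3 * a) * (m * L) ≤ T := by
  have h1 : ((1 - a) * m - y) * ((1 - a) * L) ≤ (P - y) * ((1 - a) * L) :=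
    mul_le_mul_of_nonneg_right (by linarith) (by nlinarith)
  have h2 : 0 ≤ a * (y * L) := by positivity
  have h3 : 0 ≤ a ^ 2 * (m * L) := by positivity
  nlinarith [hLB, h1, hy, h2, h3]

/-! ### The eventual inequalities: level, cut, cut cost -/

section Eventually

variable {w : ℕ → ℝ} {D : ℝ} {k : ℕ}

/-- The level `D log^k n` is eventually positive (`D > 0`). -/
theorem eventually_level_pos (hD : 0 < D) : ∀ᶠ n : ℕ in atTop, 0 < D * Real.log (n : ℝ) ^ k := by
  filter_upwards [eventually_ge_atTop 2] with n hn
  have h2 : (2 : ℝ) ≤ n := by exact_mod_cast hn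
  have := Real.log_pos (by linarith : (1 : ℝ) < n)
  positivity

/-- From `w(n) ≤ (1 + c) D log^k n` for large `n` (`w ≥ 0`, `D > 0`, `k ≠ 0`): eventually in `x`, every
`1 ≤ n ≤ x` has `w(n) ≤ (1 + c) D log^k x`. -/
theorem eventually_weight_le_level (hk : k ≠ 0) (hD : 0 < D) {c : ℝ} (hc : 0 < c)
    (hw0 : ∀ n : ℕ, 0 ≤ w n) (hwU : ∀ᶠ n : ℕ in atTop, w n ≤ (1 + c) * (D * Real.log n ^ k)) :
    ∀ᶠ x : ℕ in atTop, ∀ n ∈ Icc 1 x, w n ≤ (1 + c) * (D * Real.log x ^ k) := by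
  obtain ⟨N, hN⟩ := eventually_atTop.mp hwU
  have hWn : ∀ n : ℕ, n < N → w n ≤ ∑ m ∈ range N, w m := fun n hn =>
    single_le_sum (f := w) (fun m _ => hw0 m) (mem_range.mpr hn)
  have hlogT : Tendsto (fun x : ℕ => Real.log (x : ℝ)) atTop atTop :=
    Real.tendsto_log_atTop.comp tendsto_natCast_atTop_atTop
  have hlevT : Tendsto (fun x : ℕ => (1 + c) * (D * Real.log (x : ℝ) ^ k)) atTop atTop :=
    Tendsto.const_mul_atTop (by linarith) (Tendsto.const_mul_atTop hD
      ((tendsto_pow_atTop hk).comp hlogT))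
  filter_upwards [hlevT.eventually_ge_atTop (∑ m ∈ range N, w m)] with x hxW n hn
  obtain ⟨hn1, hnx⟩ := mem_Icc.mp hn
  by_cases hnN : n < N
  · exact (hWn n hnN).trans hxW
  · have hlog0 : 0 ≤ Real.log n := Real.log_nonneg (by exact_mod_cast hn1)
    have hlog : Real.log n ≤ Real.log x :=
      Real.log_le_log (by exact_mod_cast hn1) (by exact_mod_cast hnx)
    have h2 : D * Real.log n ^ k ≤ D * Real.log x ^ k :=
      mul_le_mul_of_nonneg_left (pow_le_pow_left₀ hlog0 hlog k) hD.le
    exact (hN n (not_lt.mp hnN)).trans (mul_le_mul_of_nonneg_left h2 (by linarith))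

/-- From `(1 - a/2) D log^k n ≤ w(n)` for large `n` (`0 < a ≤ 1`): eventually in `x`, every `n` beyond the cut
`⌊x^{1 - a/(2(k+1))}⌋` has `(1 - a) D log^k x ≤ w(n)`. -/
theorem eventually_level_le_weight_beyond_cut (hD : 0 < D) {a : ℝ} (ha : 0 < a) (ha1 : a ≤ 1)
    (hwL : ∀ᶠ n : ℕ in atTop, (1 - a / 2) * (D * Real.log n ^ k) ≤ w n) :
    ∀ᶠ x : ℕ in atTop, ∀ n : ℕ, ⌊(x : ℝ) ^ (1 - a / (2 * (k + 1)))⌋₊ < n →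
      (1 - a) * (D * Real.log x ^ k) ≤ w n := by
  set ε : ℝ := a / (2 * (k + 1)) with hε
  have hk1 : (1 : ℝ) ≤ k + 1 := by
    have : (0 : ℝ) ≤ k := Nat.cast_nonneg k
    linarith
  have hε0 : 0 < ε := by positivity
  have hε1 : ε ≤ 1 / 2 := by
    rw [hε, div_le_iff₀ (by positivity)]
    nlinarith
  have hkε : (k : ℝ) * ε ≤ a / 2 := by
    rw [hε, mul_div_assoc', div_le_iff₀ (by positivity)]
    nlinarith [Nat.cast_nonneg (α := ℝ) k]
  obtain ⟨N, hN⟩ := eventually_atTop.mp hwL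
  have hcutT : Tendsto (fun x : ℕ => (x : ℝ) ^ (1 - ε)) atTop atTop :=
    (tendsto_rpow_atTop (by linarith)).comp tendsto_natCast_atTop_atTop
  filter_upwards [hcutT.eventually_ge_atTop (N : ℝ), eventually_ge_atTop 2] with x hxN hx2 n hn
  have hX : (2 : ℝ) ≤ x := by exact_mod_cast hx2
  have hX0 : (0 : ℝ) < x := by linarith
  have hlogx : 0 < Real.log x := Real.log_pos (by linarith)
  have hNn : N ≤ n := by
    have : N ≤ ⌊(x : ℝ) ^ (1 - ε)⌋₊ := Nat.le_floor hxN
    omega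
  have hyn : (x : ℝ) ^ (1 - ε) < n :=
    (Nat.lt_floor_add_one _).trans_le (by exact_mod_cast hn)
  have hlog : (1 - ε) * Real.log x ≤ Real.log n := by
    rw [← Real.log_rpow hX0]
    exact Real.log_le_log (Real.rpow_pos_of_pos hX0 _) hyn.le
  have hpow : (1 - ε) ^ k * Real.log x ^ k ≤ Real.log n ^ k := by
    rw [← mul_pow]
    exact pow_le_pow_left₀ (by nlinarith) hlog k
  have hbern : 1 - (k : ℝ) * ε ≤ (1 - ε) ^ k := by
    have hb := one_add_mul_le_pow (show (-2 : ℝ) ≤ -ε by linarith) k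
    rw [show (1 : ℝ) + -ε = 1 - ε by ring, show (1 : ℝ) + (k : ℝ) * -ε = 1 - k * ε by ring] at hb
    exact hb
  have hlk : 0 ≤ D * Real.log x ^ k := by positivity
  have h1 : (1 - a / 2) * (D * Real.log x ^ k) ≤ D * Real.log n ^ k :=
    calc (1 - a / 2) * (D * Real.log x ^ k) ≤ (1 - k * ε) * (D * Real.log x ^ k) :=
          mul_le_mul_of_nonneg_right (by linarith) hlk
      _ ≤ (1 - ε) ^ k * (D * Real.log x ^ k) := mul_le_mul_of_nonneg_right hbern hlk
      _ = D * ((1 - ε) ^ k * Real.log x ^ k) := by ring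
      _ ≤ D * Real.log n ^ k := mul_le_mul_of_nonneg_left hpow hD.le
  calc (1 - a) * (D * Real.log x ^ k) ≤ (1 - a / 2) * ((1 - a / 2) * (D * Real.log x ^ k)) := by
        nlinarith [mul_nonneg (sq_nonneg a) hlk]
    _ ≤ (1 - a / 2) * (D * Real.log n ^ k) := mul_le_mul_of_nonneg_left h1 (by linarith)
    _ ≤ w n := hN n hNn

/-- The cut costs nothing: `⌊x^{1-ε}⌋ · D log^k x ≤ a x` eventually, for all `ε, a > 0`. -/
theorem eventually_cut_mul_level_le (hD : 0 < D) {ε : ℝ} (hε : 0 < ε) {a : ℝ} (ha : 0 < a) :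
    ∀ᶠ x : ℕ in atTop, (⌊(x : ℝ) ^ (1 - ε)⌋₊ : ℝ) * (D * Real.log x ^ k) ≤ a * x := by
  have e2 : ∀ᶠ t : ℝ in atTop, ‖Real.log t ^ (k : ℝ)‖ ≤ a / D * ‖t ^ ε‖ :=
    (isLittleO_log_rpow_rpow_atTop (k : ℝ) hε).bound (by positivity)
  filter_upwards [tendsto_natCast_atTop_atTop.eventually e2, eventually_ge_atTop 1] with x hx hx1
  have hX0 : (0 : ℝ) < x := by exact_mod_cast hx1
  have hlog0 : 0 ≤ Real.log x := Real.log_nonneg (by exact_mod_cast hx1)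
  rw [Real.rpow_natCast, Real.norm_eq_abs, Real.norm_eq_abs, abs_of_nonneg (pow_nonneg hlog0 _),
    abs_of_pos (Real.rpow_pos_of_pos hX0 _)] at hx
  have hfl : (⌊(x : ℝ) ^ (1 - ε)⌋₊ : ℝ) ≤ (x : ℝ) ^ (1 - ε) := Nat.floor_le (by positivity)
  have hDx : D * Real.log x ^ k ≤ D * (a / D * (x : ℝ) ^ ε) := mul_le_mul_of_nonneg_left hx hD.le
  calc (⌊(x : ℝ) ^ (1 - ε)⌋₊ : ℝ) * (D * Real.log x ^ k)
      ≤ (x : ℝ) ^ (1 - ε) * (D * (a / D * (x : ℝ) ^ ε)) :=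
        mul_le_mul hfl hDx (by positivity) (by positivity)
    _ = a * ((x : ℝ) ^ (1 - ε) * (x : ℝ) ^ ε) := by
        field_simp
    _ = a * x := by rw [← Real.rpow_add hX0, sub_add_cancel, Real.rpow_one]

end Eventually

/-! ### The four one-sided transfers and the equivalence -/

section Transfers

variable {p : ℕ → Prop} [DecidablePred p] {w : ℕ → ℝ} {C D : ℝ} {k : ℕ}

/-- **Weighted sum ≤ ⟹ count ≤** (weights `~ D log^k n`). -/
theorem eventually_card_le_of_weightedSum_le_pow (hD : 0 < D) (hC : 0 < C)
    (hw0 : ∀ n : ℕ, 0 ≤ w n) (hw : w ~[atTop] fun n : ℕ => D * Real.log n ^ k)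
    (hθ : ∀ c : ℝ, 0 < c → ∀ᶠ x : ℕ in atTop,
      ∑ n ∈ (Icc 1 x).filter p, w n ≤ (1 + c) * (C * x)) :
    ∀ c : ℝ, 0 < c → ∀ᶠ x : ℕ in atTop,
      (#((Icc 1 x).filter p) : ℝ) ≤ (1 + c) * (C / D * x / Real.log x ^ k) := by
  have hwb := (isEquivalent_iff_upper_lower (eventually_level_pos (k := k) hD)).mp hw
  intro c hc
  set a : ℝ := min c 1 / 8 with ha
  have hmin1 := min_le_right c 1
  have hminc := min_le_left c 1
  have ha0 : 0 < a := by have := lt_min hc one_pos; positivity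
  have ha1 : a ≤ 1 / 8 := by rw [ha]; linarith
  have hLo := eventually_level_le_weight_beyond_cut (k := k) hD ha0 (by linarith)
    (hwb.2 (a / 2) (by positivity))
  have hcut := eventually_cut_mul_level_le (k := k) hD (ε := a / (2 * (k + 1))) (by positivity)
    (a := a * C) (by positivity)
  filter_upwards [hθ a ha0, hLo, hcut, eventually_ge_atTop 2] with x hT hL hy hx2
  have hX : (2 : ℝ) ≤ x := by exact_mod_cast hx2
  have hX0 : (0 : ℝ) < x := by linarith
  have hℓ : 0 < Real.log (x : ℝ) := Real.log_pos (by linarith)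
  have hL0 : 0 < D * Real.log (x : ℝ) ^ k := by positivity
  set m := C / D * (x : ℝ) / Real.log x ^ k with hm_def
  have hm : m * (D * Real.log (x : ℝ) ^ k) = C * x := by
    rw [hm_def]
    field_simp
  have hm0 : 0 < m := by positivity
  have hLB := card_sub_mul_le_weightedCount (p := p) hw0 x
    ⌊(x : ℝ) ^ (1 - a / (2 * (k + 1)))⌋₊ (L := (1 - a) * (D * Real.log (x : ℝ) ^ k))
    (by nlinarith) fun n hn => hL n hn
  rw [← hm] at hT
  rw [mul_assoc, ← hm] at hy
  have key := card_upper_core_pow hL0 hm0 ha0 ha1 hLB hT hy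
  calc _ ≤ (1 + 4 * a) * m := key
    _ ≤ (1 + c) * m := mul_le_mul_of_nonneg_right (by linarith) hm0.le

/-- **Weighted sum ≥ ⟹ count ≥** (weights `~ D log^k n`, `k ≠ 0`). -/
theorem eventually_le_card_of_le_weightedSum_pow (hk : k ≠ 0) (hD : 0 < D) (hC : 0 < C)
    (hw0 : ∀ n : ℕ, 0 ≤ w n) (hw : w ~[atTop] fun n : ℕ => D * Real.log n ^ k)
    (hθ : ∀ c : ℝ, 0 < c → ∀ᶠ x : ℕ in atTop,
      (1 - c) * (C * x) ≤ ∑ n ∈ (Icc 1 x).filter p, w n) :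
    ∀ c : ℝ, 0 < c → ∀ᶠ x : ℕ in atTop,
      (1 - c) * (C / D * x / Real.log x ^ k) ≤ (#((Icc 1 x).filter p) : ℝ) := by
  have hwb := (isEquivalent_iff_upper_lower (eventually_level_pos (k := k) hD)).mp hw
  intro c hc
  set a : ℝ := min c 1 / 2 with ha
  have hmin1 := min_le_right c 1
  have hminc := min_le_left c 1
  have ha0 : 0 < a := by have := lt_min hc one_pos; positivity
  have hU := eventually_weight_le_level hk hD ha0 hw0 (hwb.1 a ha0)
  filter_upwards [hθ a ha0, hU, eventually_ge_atTop 2] with x hT hUx hx2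
  have hX : (2 : ℝ) ≤ x := by exact_mod_cast hx2
  have hX0 : (0 : ℝ) < x := by linarith
  have hℓ : 0 < Real.log (x : ℝ) := Real.log_pos (by linarith)
  have hL0 : 0 < D * Real.log (x : ℝ) ^ k := by positivity
  set m := C / D * (x : ℝ) / Real.log x ^ k with hm_def
  have hm : m * (D * Real.log (x : ℝ) ^ k) = C * x := by
    rw [hm_def]
    field_simp
  have hm0 : 0 < m := by positivity
  have hUB := weightedCount_le_card_mul_of_le (p := p) x hUx
  rw [← hm] at hT
  have key := card_lower_core_pow hL0 hm0 ha0 hUB hT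
  calc (1 - c) * m ≤ (1 - 2 * a) * m := mul_le_mul_of_nonneg_right (by linarith) hm0.le
    _ ≤ _ := key

/-- **Count ≤ ⟹ weighted sum ≤** (weights `~ D log^k n`, `k ≠ 0`). -/
theorem eventually_weightedSum_le_of_card_le_pow (hk : k ≠ 0) (hD : 0 < D) (hC : 0 < C)
    (hw0 : ∀ n : ℕ, 0 ≤ w n) (hw : w ~[atTop] fun n : ℕ => D * Real.log n ^ k)
    (hP : ∀ c : ℝ, 0 < c → ∀ᶠ x : ℕ in atTop,
      (#((Icc 1 x).filter p) : ℝ) ≤ (1 + c) * (C / D * x / Real.log x ^ k)) :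
    ∀ c : ℝ, 0 < c → ∀ᶠ x : ℕ in atTop,
      ∑ n ∈ (Icc 1 x).filter p, w n ≤ (1 + c) * (C * x) := by
  have hwb := (isEquivalent_iff_upper_lower (eventually_level_pos (k := k) hD)).mp hw
  intro c hc
  set a : ℝ := min c 1 / 3 with ha
  have hmin1 := min_le_right c 1
  have hminc := min_le_left c 1
  have ha0 : 0 < a := by have := lt_min hc one_pos; positivity
  have ha1 : a ≤ 1 := by rw [ha]; linarith
  have hU := eventually_weight_le_level hk hD ha0 hw0 (hwb.1 a ha0)
  filter_upwards [hP a ha0, hU, eventually_ge_atTop 2] with x hPx hUx hx2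
  have hX : (2 : ℝ) ≤ x := by exact_mod_cast hx2
  have hX0 : (0 : ℝ) < x := by linarith
  have hℓ : 0 < Real.log (x : ℝ) := Real.log_pos (by linarith)
  have hL0 : 0 < D * Real.log (x : ℝ) ^ k := by positivity
  set m := C / D * (x : ℝ) / Real.log x ^ k with hm_def
  have hm : m * (D * Real.log (x : ℝ) ^ k) = C * x := by
    rw [hm_def]
    field_simp
  have hm0 : 0 < m := by positivity
  have hUB := weightedCount_le_card_mul_of_le (p := p) x hUx
  rw [← hm]
  have key := weightedSum_upper_core_pow hL0 hm0 ha0 ha1 hUB hPx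
  calc _ ≤ (1 + 3 * a) * (m * (D * Real.log (x : ℝ) ^ k)) := key
    _ ≤ (1 + c) * (m * (D * Real.log (x : ℝ) ^ k)) :=
        mul_le_mul_of_nonneg_right (by linarith) (by positivity)

/-- **Count ≥ ⟹ weighted sum ≥** (weights `~ D log^k n`). -/
theorem eventually_le_weightedSum_of_le_card_pow (hD : 0 < D) (hC : 0 < C)
    (hw0 : ∀ n : ℕ, 0 ≤ w n) (hw : w ~[atTop] fun n : ℕ => D * Real.log n ^ k)
    (hP : ∀ c : ℝ, 0 < c → ∀ᶠ x : ℕ in atTop,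
      (1 - c) * (C / D * x / Real.log x ^ k) ≤ (#((Icc 1 x).filter p) : ℝ)) :
    ∀ c : ℝ, 0 < c → ∀ᶠ x : ℕ in atTop,
      (1 - c) * (C * x) ≤ ∑ n ∈ (Icc 1 x).filter p, w n := by
  have hwb := (isEquivalent_iff_upper_lower (eventually_level_pos (k := k) hD)).mp hw
  intro c hc
  set a : ℝ := min c 1 / 3 with ha
  have hmin1 := min_le_right c 1
  have hminc := min_le_left c 1
  have ha0 : 0 < a := by have := lt_min hc one_pos; positivity
  have ha1 : a ≤ 1 := by rw [ha]; linarith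
  have hLo := eventually_level_le_weight_beyond_cut (k := k) hD ha0 ha1
    (hwb.2 (a / 2) (by positivity))
  have hcut := eventually_cut_mul_level_le (k := k) hD (ε := a / (2 * (k + 1))) (by positivity)
    (a := a * C) (by positivity)
  filter_upwards [hP a ha0, hLo, hcut, eventually_ge_atTop 2] with x hPx hL hy hx2
  have hX : (2 : ℝ) ≤ x := by exact_mod_cast hx2
  have hX0 : (0 : ℝ) < x := by linarith
  have hℓ : 0 < Real.log (x : ℝ) := Real.log_pos (by linarith)
  have hL0 : 0 < D * Real.log (x : ℝ) ^ k := by positivity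
  set m := C / D * (x : ℝ) / Real.log x ^ k with hm_def
  have hm : m * (D * Real.log (x : ℝ) ^ k) = C * x := by
    rw [hm_def]
    field_simp
  have hm0 : 0 < m := by positivity
  have hLB := card_sub_mul_le_weightedCount (p := p) hw0 x
    ⌊(x : ℝ) ^ (1 - a / (2 * (k + 1)))⌋₊ (L := (1 - a) * (D * Real.log (x : ℝ) ^ k))
    (by nlinarith) fun n hn => hL n hn
  rw [mul_assoc, ← hm] at hy
  rw [← hm]
  have key := weightedSum_lower_core_pow hL0 hm0 ha0 ha1 (Nat.cast_nonneg _) hLB hPx hy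
  calc (1 - c) * (m * (D * Real.log (x : ℝ) ^ k)) ≤ (1 - 3 * a) * (m * (D * Real.log (x : ℝ) ^ k)) :=
        mul_le_mul_of_nonneg_right (by linarith) (by positivity)
    _ ≤ _ := key

/-- **The partial summation for weights `w ~ D log^k n`, both ways:
`θ(x) ~ C x ⟺ P(x) ~ (C/D) · x / log^k x`** (`w ≥ 0`, `C, D > 0`, `k ≠ 0`). -/
theorem isEquivalent_weightedSum_iff_card_pow (hk : k ≠ 0) (hD : 0 < D) (hC : 0 < C)
    (hw0 : ∀ n : ℕ, 0 ≤ w n) (hw : w ~[atTop] fun n : ℕ => D * Real.log n ^ k) :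
    ((fun x : ℕ => ∑ n ∈ (Icc 1 x).filter p, w n) ~[atTop] fun x : ℕ => C * (x : ℝ)) ↔
      ((fun x : ℕ => (#((Icc 1 x).filter p) : ℝ)) ~[atTop]
        fun x : ℕ => C / D * (x : ℝ) / Real.log x ^ k) := by
  have hv1 : ∀ᶠ x : ℕ in atTop, 0 < C * (x : ℝ) := by
    filter_upwards [eventually_ge_atTop 1] with x hx
    have : (0 : ℝ) < x := Nat.cast_pos.mpr (by omega)
    positivity
  have hv2 : ∀ᶠ x : ℕ in atTop, 0 < C / D * (x : ℝ) / Real.log x ^ k := by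
    filter_upwards [eventually_ge_atTop 2] with x hx
    have hX : (2 : ℝ) ≤ x := by exact_mod_cast hx
    have := Real.log_pos (by linarith : (1 : ℝ) < x)
    positivity
  rw [isEquivalent_iff_upper_lower hv1, isEquivalent_iff_upper_lower hv2]
  constructor
  · rintro ⟨h1, h2⟩
    exact ⟨eventually_card_le_of_weightedSum_le_pow hD hC hw0 hw h1,
      eventually_le_card_of_le_weightedSum_pow hk hD hC hw0 hw h2⟩
  · rintro ⟨h1, h2⟩
    exact ⟨eventually_weightedSum_le_of_card_le_pow hk hD hC hw0 hw h1,
      eventually_le_weightedSum_of_le_card_pow hD hC hw0 hw h2⟩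

end Transfers

end Summit.Parity.BatemanHorn.Theorems
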